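import Mathlib
import HarnessLib
import Literature.NumberTheory.GelbartRogawski1991.WeilRepresentationsAPackets
import Literature.NumberTheory.GelbartRogawski1991.Sec2Defs

/-!
# Gelbart–Rogawski 1991, §3.3–§3.4 (pp. 458–461) — the DATUM: the mixed-model spaces `𝒮(E_𝔸, 𝓕)` with
# the oscillator representations `ω_ψ^s`, theta-functionals and the theta functional `θ` of (3.3.1),
# `L²(G(F)\G(𝔸))`, the centre `Z(𝔸)` with its automorphic characters and `∫_{Z(F)\Z(𝔸)}`, «the closure of
# `S` generates an irreducible automorphic representation of class `π`», the parametrisation `τ(γ, ψ, χ)`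
# of `R^∧` (p. 460) and the map `τ ↦ ω(τ)` (Remark p. 461) — ONE structure `GR91ThetaData` over the ★
# dictionary `GR91Spectrum` and the §2 datum `Sec2Defs.GR91RData`, plus the objects §3.3–§3.4 DEFINE, as
# real definitions (squad TG carrier file `Sec3ThetaDefs`; the printed ASSERTIONS are the predicates of
# `Sec3Theta.lean`, and §4.2's `ω(τ*)` in `Sec4Defs.lean`, which import this)

Source: S. Gelbart, J. Rogawski, *L-functions and Fourier–Jacobi coefficients for the unitary group `U(3)`*,
Invent. Math. **105** (1991) 445–472 [GelbartRogawski1991], §3.3 «Theta-series» (p. 458 foot – p. 459) and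
§3.4 «Weil representations» (pp. 459–462).  Every quotation «…» was read on the page IMAGES of the printed
article (open GDZ digitisation PPN356556735_0105, canvas = page + 6; images + OCR at
`run/shared/lean/pub/pub-hodgecm/pub-hodgecm-cf-rogawski-g6/lit/GR91-invent105/`; the OCR was used only to
locate; the lit store does not hold the paper).  «p. N» = printed page; «Lk» = approximate body line.

SCOPE (printed, §1.1 p. 449): `E/F` a quadratic extension of NUMBER FIELDS; `G` = the QUASI-SPLIT `U(3)` of
`Φ`; «`Z` = center of `G` (isomorphic to `E¹`)»; `B = MN`, `U` = center of `N`, `R` = centralizer of `U` in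
`B`; p. 460: «`R = Z S′ N`, where `S′ = {d(1, β, 1) : β ∈ E¹}`».  The compatible splittings `s = s(ψ, γ)` of
`G(𝔸) → Mp_𝔸(W)` are those of Prop. 3.1.1 (★ `SplittingDatum.CompatibleSplitting`, NOT restated; §3.1
Remark p. 457 L4–8: «a choice of `s` is equivalent to a choice of Hecke character of `E` whose restriction to
`F` is `ω_{E/F}`, once `ψ` is fixed»; §3.2 Remark (3) p. 458: «By `ω(ψ, γ)` we denote the representation
`g ↦ ω_ψ(s(ψ, γ)(g))` of `U(V)`»).

## Transcription level

That of ★ `WeilRepresentationsAPackets.lean` (dictionary `GR91Spectrum`: `X.Rep`, `X.weil γ ψ χ`,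
`X.OmegaHecke` ∋ `γ`, `X.AddChar` ∋ `ψ`, `X.Char1` ∋ `χ`, `X.NormClassEq` — IMPORTED AND REUSED, not
re-posited) and of `Sec2Defs.lean` (datum `J : GR91RData X GA` over the ambient group `GA` = `G(𝔸)` with its
`Group` structure from the context: the subgroups `G(F)`, `U(𝔸) ⊆ N(𝔸) ⊆ R(𝔸) ⊆ B(𝔸)`, the Fourier–Jacobi
coefficient `J.fj ψ φ = φ_ψ`, the set `J.RHat = R^∧` of infinite-dimensional irreducible constituents of
`L²(R(F)\R(𝔸))` RECORDED BY THEIR SUBSPACES of functions on `R(𝔸)`, `J.RHatPsi ψ = R^∧(ψ)`, the twists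
`J.twist (ν₁, ν₂) τ = τ ⊗ ν` and the `B(F)`-orbit relation `J.SameOrbit` — IMPORTED AND REUSED).  This file
POSITS, as the fields of ONE structure `GR91ThetaData X J`, the objects of §3.3–§3.4 that the print speaks about
and does not construct from the above, and DEFINES (class **DEF**, verbatim quotation + locator) what the print
defines over them: `θ_{Φ,s}` (`thetaSeries`), `Θ(γ, ψ)` (`Theta`), `θ_{χ,γ}` (`thetaChi`), `Θ(γ, ψ, χ)`
(`ThetaChi`).  NOTHING IS ASSERTED here: no `Prop`-valued statement of the paper (those are in
`Sec3Theta.lean`), **no `sorry`, no axiom, no instance, no notation, no theorem**; the only `Prop`-typed field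
is the subgroup inclusion `Z ≤ R` that holds by §1.1 and is recorded like `Sec2Defs`' `U_le_N`.

## References

* [GelbartRogawski1991] §3.3–§3.4 pp. 458–462 ((3.3.1), `θ_Φ`, `θ_{Φ,s}`, `Θ(γ,ψ)`, `Θ(γ,ψ,χ)`, `θ_{χ,γ}`,
  `ω(γ,ψ,χ)`, `Ω`, `τ(γ,ψ,χ)`, Remark after Theorem 3.4); §1.1 p. 449; §3.1 Remark p. 457; §3.2 p. 457, Remark
  (3) p. 458.
* Tree: ★ `Literature.NumberTheory.GelbartRogawski1991.GR91Spectrum` (`WeilRepresentationsAPackets.lean`);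
  `Literature.NumberTheory.GelbartRogawski1991.Sec2Defs.GR91RData` (`Sec2Defs.lean`, squad TG, seat TG-t01).
-/

noncomputable section

namespace Literature.NumberTheory.GelbartRogawski1991.Sec3ThetaDefs

open Sec2Defs

universe u

/-- **`GR91ThetaData X J` — the posited datum of [GelbartRogawski1991] §3.3–§3.4** over the ★ dictionary
`X : GR91Spectrum` and the §2 datum `J : GR91RData X GA` (`GA` = `G(𝔸)`).  Fields, with the printed meaning:
* `Schwartz ψ` — the space `𝒮(E_𝔸, 𝓕)` of the mixed model, §3.2 p. 457 L14–20: «Let `(ρ_ψ¹, 𝓕)` be the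
  space of a global `ψ`-representation of `H_𝔸(W₂)`. The mixed model with respect to the decomposition
  `W = W₁₃ ⊕ W₂` is a realization of `ω_ψ` on the space `𝒮(W₃(𝔸), 𝓕)` (cf. [MVW, GR₁] for the local case). We
  identify `W₃(𝔸)` with `E_𝔸` and write `𝒮(E_𝔸, 𝓕)`»; it depends on `ψ` only;
* `omega γ ψ g` — the operator `ω_ψ^s(g)`, `g ∈ G(𝔸)`, on `𝒮(E_𝔸, 𝓕)`, for the compatible splitting
  `s = s(ψ, γ)` (§3.1 Remark p. 457 L9–11: «We denote by `ω_ψ^s` the representation `ω_ψ ∘ s` of `G(𝔸)`.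
  Such a representation will be called a oscillator representation of `G(𝔸)`»; §3.2 Remark (3) p. 458);
* `IsThetaFunctional ψ ℓ` — `ℓ` is an «`H(F)`-invariant functional» on the `ψ`-representation `𝒮(E_𝔸, 𝓕)` of
  the Heisenberg group `H_𝔸(W)` (§3.3 p. 458, last three lines: «Recall that if `ρ_ψ` is a `ψ`-representation
  of a Heisenberg group `H(𝔸)`, then there is a unique (up to multiples) `H(F)`-invariant functional on `ρ_ψ`,
  called the theta functional»; p. 459 L4–8);
* `theta ψ` — THE theta functional `θ` of (3.3.1): «Let `θ₁ : 𝓕 → ℂ` be a theta-functional on `𝓕` and for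
  `Φ ∈ 𝒮(E_𝔸, 𝓕)`, set (3.3.1) `θ(Φ) = Σ_{x∈E} θ₁(Φ(x))`» (p. 458 last line – p. 459 L3);
* `L2` — `L²(G(F) \ G(𝔸))` (Prop. 3.4.1 (1)), read as the subspace of functions on `G(𝔸)` that are left
  `G(F)`-invariant and square-integrable on `G(F)\G(𝔸)`;
* `Z` — `Z(𝔸)`, «the center `Z` of `G`» (§3.4 p. 459 L15; §1.1 «isomorphic to `E¹`»), with `Z_le_R` the
  inclusion `Z ⊆ R = Z S′ N` (p. 460) that holds by §1.1;
* `charZ χ` — the automorphic character `χ` of `U(1) ≅ Z` as a function on `Z(𝔸)` (trivial on `Z(F)`)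
  (§3.4 p. 459 L15: «If `χ` is an automorphic character of the center `Z` of `G`»; p. 446: «for each
  automorphic character `χ` of `U(1)`, the subrepresentation … on which `Z(𝔸)` acts via `χ`»);
* `intZ f = ∫_{Z(F)\Z(𝔸)} f(z) dz` — the invariant integral over the compact quotient (p. 459, display
  defining `θ_{χ,γ}`), as a functional on functions on `Z(𝔸)` (meaningful on left-`Z(F)`-invariant integrable
  functions; unspecified elsewhere);
* `ClosureGenerates S π` — «the closure of `S` in `L²(G(F) \ G(𝔸))` generates a[n] irreducible automorphic
  representation» (Prop. 3.4.1 (2), p. 459; `G(𝔸)` acting by right translation) whose isomorphism class is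
  `π : X.Rep` (p. 460 L19–20: «We denote the representation on `Θ(γ, ψ, χ)` by `ω(γ, ψ, χ)`»);
* `tau γ ψ χ` — the subspace of functions on `R(𝔸)` carrying `τ(γ, ψ, χ) = τ(s′, ψ, χ) ∈ R^∧`, constructed
  on p. 460 L21 – p. 461 L3: «We now introduce a parametrization of `R^∧` by the data `(γ, ψ, χ)`. First,
  observe that elements of `R^∧` may be constructed as follows. Recall (§1.1) that `N` is the Heisenberg
  group attached to `E`, and let `V` be the space of a `ψ`-representation of `N(𝔸)`. The metaplectic group
  `Mp_𝔸(E)` also acts on `V`, and we denote by `ω` the joint action of `N(𝔸) ⋊ Mp_𝔸(E)` on `V`. Observe that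
  `R = ZS′N`, where `S′ = {d(1, β, 1) : β ∈ E¹}`. The action of `S′(𝔸)` on `N(𝔸)` by conjugation yields an
  embedding of `S′(𝔸)` in `Sp_𝔸(E)`. Fixing a compatible splitting `s′ : S′(𝔸) → Mp_𝔸(E)` (which exists by
  Proposition 3.1.1), we obtain an action of `S′(𝔸)N(𝔸)` on `V`. Let `θ₁` be a theta functional on `V`, and
  for all `v ∈ V` define `φ_v(zsn) = χ(z)θ¹(ω(sn)v)` for `z ∈ Z(𝔸)`, `s ∈ S′(𝔸)`[,] `n ∈ N(𝔸)`. Then `φ_v`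
  belongs to `L²(R(F) \ R(𝔸))`, and the map `v → φ_v` is a embedding of `R(𝔸)`-representations. The
  representation on the space of functions `{φ_v}` will be denoted by `τ(s′, ψ, χ)`. … Next, observe that the
  data `(s′, ψ)` determines `ω_ψ^{s′}`, hence a mixed model for `G = U(3)` as in §3.2, and hence a Hecke
  character `γ` of `E`. The choices `(s′, ψ)` or `(γ, ψ)` mutually determine each other and hence we can
  denote `τ(s′, ψ, χ)` by `τ(γ, ψ, χ)`.» — in the currency of `Sec2Defs` (constituents recorded by their
  subspaces, `J.RHat : Set (Submodule ℂ (R(𝔸) → ℂ))`) `tau γ ψ χ` is that space `{φ_v}`;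
* `weilOfR τ` — the map `τ → ω(τ)` of the Remark after Theorem 3.4 (p. 461: «For `τ = τ(γ, ψ, χ) ∈ R^∧`, set
  `ω(τ) = ω(γ, ψ, χ)`»), as a total function on subspaces (meaningful on `R^∧`; §4.2 p. 462 uses it as
  «`ω = ω(τ*)`»).
NOTHING is asserted by the datum. [cite: GelbartRogawski1991, §3.3–§3.4 pp. 458–461] -/
structure GR91ThetaData (X : GR91Spectrum.{u}) {GA : Type u} [Group GA] (J : GR91RData X GA) :
    Type (u + 1) where
  /-- `𝒮(E_𝔸, 𝓕)`, the space of the mixed model for `ψ` [§3.2 p. 457 L14–20] -/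
  Schwartz : X.AddChar → Type u
  /-- `ω_ψ^s(g)`, `s = s(ψ, γ)`, `g ∈ G(𝔸)` [§3.1 Remark p. 457 L9–11; §3.2 Remark (3) p. 458] -/
  omega : (γ : X.OmegaHecke) → (ψ : X.AddChar) → GA → Schwartz ψ → Schwartz ψ
  /-- «`H(F)`-invariant functional» on the `ψ`-representation `𝒮(E_𝔸, 𝓕)` of `H_𝔸(W)` [§3.3 pp. 458–459] -/
  IsThetaFunctional : (ψ : X.AddChar) → (Schwartz ψ → ℂ) → Prop
  /-- the theta functional `θ` of (3.3.1) [§3.3 p. 459 L1–3] -/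
  theta : (ψ : X.AddChar) → Schwartz ψ → ℂ
  /-- `L²(G(F)\G(𝔸))`, as a subspace of the functions on `G(𝔸)` [Prop. 3.4.1 (1) p. 459] -/
  L2 : Submodule ℂ (GA → ℂ)
  /-- `Z(𝔸)`, `Z` = center of `G` [§1.1 p. 449; §3.4 p. 459 L15] -/
  Z : Subgroup GA
  /-- `Z ⊆ R = Z S′ N` (by §1.1 / p. 460) -/
  Z_le_R : Z ≤ J.R
  /-- the automorphic character `χ` of `Z ≅ U(1)` as a function on `Z(𝔸)` [§3.4 p. 459 L15] -/
  charZ : X.Char1 → Z → ℂ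
  /-- `∫_{Z(F)\Z(𝔸)}` [§3.4 p. 459, display] -/
  intZ : (Z → ℂ) → ℂ
  /-- «the closure of `S` in `L²(G(F)\G(𝔸))` generates an irreducible automorphic representation», of class
  `π` [Prop. 3.4.1 (2) p. 459; p. 460 L19–20] -/
  ClosureGenerates : Submodule ℂ (GA → ℂ) → X.Rep → Prop
  /-- the subspace of functions on `R(𝔸)` carrying `τ(γ, ψ, χ) ∈ R^∧` [p. 460 L21 – p. 461 L3] -/
  tau : X.OmegaHecke → X.AddChar → X.Char1 → Submodule ℂ (J.R → ℂ)
  /-- `τ ↦ ω(τ)` [Remark after Thm. 3.4, p. 461; §4.2 p. 462 «`ω = ω(τ*)`»] -/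
  weilOfR : Submodule ℂ (J.R → ℂ) → X.Rep

namespace GR91ThetaData

variable {X : GR91Spectrum.{u}} {GA : Type u} [Group GA] {J : GR91RData X GA} (D : GR91ThetaData X J)

/-- **DEF — the theta series `θ_{Φ,s}` on `G(𝔸)`, `s = s(ψ, γ)`.** «A theta series, in the sense of Weil, is a
function of `m ∈ Mp_𝔸(W)` defined by `θ_Φ(m) = θ(ω_ψ(m)Φ)` for `Φ ∈ 𝒮(E_𝔸, 𝓕)`. It is well-known that `θ_Φ(m)`
is a smooth function on `Sp_F(W) \ Mp_𝔸(W)`. If `s` is a compatible section as in Proposition 3.1.1, let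
`θ_{Φ,s}(g) = θ_Φ(s(g))` for `g ∈ G(𝔸)`»; p. 459 last display: «A typical element in `Θ(γ, ψ)` looks like
`θ_{Φ,s}(g) = Σ_{x∈E} θ₁((ω_ψ^s(g)Φ)(x))`», i.e. `θ_{Φ,s}(g) = θ(ω_ψ^s(g)Φ)` with (3.3.1).
[cite: GelbartRogawski1991, §3.3 p. 459 L9–12 and last display] -/
def thetaSeries (γ : X.OmegaHecke) (ψ : X.AddChar) (Φ : D.Schwartz ψ) : GA → ℂ :=
  fun g => D.theta ψ (D.omega γ ψ g Φ)

/-- **DEF — `Θ(s, ψ) = Θ(γ, ψ)`.** «The resulting space of "theta series" on `G(𝔸)` is denoted by `Θ(s, ψ)` or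
`Θ(γ, ψ)` (cf. Remark (3), § 3.2).»  Typed as the subspace of functions on `G(𝔸)` spanned by the `θ_{Φ,s}`,
`Φ ∈ 𝒮(E_𝔸, 𝓕)` (`Φ ↦ θ_{Φ,s}` being linear in print, the span is the printed set of theta series).
[cite: GelbartRogawski1991, §3.3 p. 459 L12–14] -/
def Theta (γ : X.OmegaHecke) (ψ : X.AddChar) : Submodule ℂ (GA → ℂ) :=
  Submodule.span ℂ (Set.range (D.thetaSeries γ ψ))

/-- the inclusion `Z(𝔸) ⊆ G(𝔸)` restricted to `Z(𝔸) ⊆ R(𝔸)` (`R = Z S′ N`).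
[cite: GelbartRogawski1991, §3.4 p. 460 L26] -/
def inclZR : D.Z →* J.R :=
  Subgroup.inclusion D.Z_le_R

/-- **DEF — the projection onto the `χ`-eigenspace of the centre**, for a function `f` on `G(𝔸)`:
`g ↦ ∫_{Z(F)\Z(𝔸)} f(zg) χ⁻¹(z) dz` (the operation printed in the definition of `θ_{χ,γ}`, p. 459).
[cite: GelbartRogawski1991, §3.4 p. 459 L16–19 (display)] -/
def eigenProj (χ : X.Char1) (f : GA → ℂ) : GA → ℂ :=
  fun g => D.intZ (fun z => f ((z : GA) * g) * (D.charZ χ z)⁻¹)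

/-- **DEF — `θ_{χ,γ}`.** «If `χ` is an automorphic character of the center `Z` of `G`, let `Θ(γ, ψ, χ)` denote
the `χ`-eigenspace of `Θ(γ, ψ)`, and let `θ_{χ,γ}(Φ)(g) = ∫_{Z(F)\Z(𝔸)} θ_{Φ,s}(zg) χ⁻¹(z) dz` denote the
composition of the map `Φ → θ_{Φ,s}` with the projection onto the `χ`-eigenspace.»
[cite: GelbartRogawski1991, §3.4 p. 459 L15–19] -/
def thetaChi (γ : X.OmegaHecke) (ψ : X.AddChar) (χ : X.Char1) (Φ : D.Schwartz ψ) : GA → ℂ :=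
  D.eigenProj χ (D.thetaSeries γ ψ Φ)

/-- **DEF — `Θ(γ, ψ, χ)`**, «the `χ`-eigenspace of `Θ(γ, ψ)`»: the image of `Θ(γ, ψ)` under the projection onto
the `χ`-eigenspace = the span of the `θ_{χ,γ}(Φ)` (the top arrow `𝒮(E_𝔸, 𝓕) → Θ(γ, ψ, χ)` of the diagram on
p. 459 is `θ_{χ,γ}`; p. 460 L19: «the representation on `Θ(γ, ψ, χ)`»).
[cite: GelbartRogawski1991, §3.4 p. 459 L15–19 and diagram] -/
def ThetaChi (γ : X.OmegaHecke) (ψ : X.AddChar) (χ : X.Char1) : Submodule ℂ (GA → ℂ) :=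
  Submodule.span ℂ (Set.range (D.thetaChi γ ψ χ))

end GR91ThetaData

/-- **DEF — `Ω`**, «Let `Ω` denote the set of all Weil representations» `ω(γ, ψ, χ)` (the ★ dictionary's
`X.weil γ ψ χ`; p. 446 L17–18: «Let `Ω` be the set of representations of `G` in the image of the Howe
correspondence for `(U(1), U(3))`»). [cite: GelbartRogawski1991, §3.4 p. 460 L19–20] -/
def Omega (X : GR91Spectrum.{u}) : Set X.Rep :=
  {π | ∃ (γ : X.OmegaHecke) (ψ : X.AddChar) (χ : X.Char1), π = X.weil γ ψ χ}

end Literature.NumberTheory.GelbartRogawski1991.Sec3ThetaDefs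

end
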